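import Literature.NumberTheory.PAdicHodge.AinfRamifiedDivisionTransportCells
import Literature.NumberTheory.PAdicHodge.FormalLogSecondKindCongruentLaws
import Literature.NumberTheory.PAdicHodge.EisensteinPowerBasisNorms
import HarnessLib

/-!
# Power-basis coordinates of `log_W` for a Weierstrass curve `W` over `𝒪_D = ℤ_p[ϖ]`: `log_W = Σ_{i<e} ϖⁱ·ℓᵢ` with
# `ℓᵢ ∈ ℚ_p⟦X⟧` log-type, and — when `W ≡ E₀ (mod ϖ)` — every `ℓᵢ` is of the SECOND KIND for `F_{E₀}`

Topic `Literature/NumberTheory/PAdicHodge` (theorems only; no definition, no named fact, no instance, no `sorry`). Setting: `F` a `p`-adic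
field, `hp : valuation F p < 1`, `D : EisensteinRoot F p hp` (Eisenstein polynomial `f ∈ ℤ_p[X]` of degree `e` with root `ϖ ∈ F`;
`𝒪_D = ℤ_p[X]/(f) = ℤ_p[ϖ]`, Mathlib `AdjoinRoot`, power basis `1, ϱ, …, ϱ^{e−1}` = `AdjoinRoot.powerBasis' D.monic`), `K₀ = PadicBase F p hp`
(`= ℚ_p` normed by `F`), `ι : K₀ → F → ℂ_F`, `φ_D : 𝒪_D → ℂ_F` (`EisensteinRoot.CoeffDisc.toCBall`), `ϖ_C = φ_D(ϱ) ∈ ℂ_F`.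

* §1 `eq_sum_coords` / `toF_eq_sum_coords` / `toCBall_eq_sum_coords` — **`φ_D(y) = Σ_{i<e} ι(yᵢ)·ϖ_Cⁱ`** where `yᵢ ∈ ℤ_p` are the
  power-basis coordinates of `y ∈ 𝒪_D` (index `i : Fin e` transported to `Fin (powerBasis').dim` by `Fin.cast`).
* §2 the EXPLICIT coordinate series `ℓᵢ = Σ_n (b_{n−1})ᵢ/n · Xⁿ ∈ K₀⟦X⟧` (`b_k ∈ 𝒪_D` the coefficients of the invariant differential
  `formalInvDiff W`, `log_W = Σ b_{n−1}/n·Xⁿ`): `constantCoeff_coord` (`ℓᵢ(0) = 0`), `norm_natCast_mul_coeff_coord_le_one` (LOG-TYPE: `‖n·[Xⁿ]ℓᵢ‖ ≤ 1`).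
* §3 `subst_sum_map` / `cocycle_sum_map` — substitution and the `F_{E₀}`-coboundary act coordinatewise:
  `Λ_{E₀}(Σ cᵢ ι_*ℓᵢ) = Σ cᵢ ι_*(Λ_{E₀} ℓᵢ)` (`F_{E₀}` has `ℤ`-coefficients), `Λ_{E₀}(g) = g(F_{E₀}(X,Y)) − g(X) − g(Y)`.
* §4 (with `[CharZero ℂ_F]`) ★ `formalLog_map_eq_sum_coords` — **`log_{W ⊗ ℂ_F} = Σ_{i<e} ϖ_Cⁱ · ι_*(ℓᵢ)`**; ★★ `norm_coeff_cocycle_coord_le` — if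
  `W ≡ E₀ (mod ϱ)` and `‖ϖ_C‖ʲ ≤ M‖j‖` (`j ≥ 1`), then **every coordinate series is of the second kind for `F_{E₀}`:
  `‖[X^d] Λ_{E₀}(ℓᵢ)‖_{K₀} ≤ M/‖p‖`** (`FormalLogSecondKindCongruentLaws.norm_coeff_formalLog_map_cocycle_wrt_int_le` bounds `Λ_{E₀}(log_W)` by `M`
  in `ℂ_F`; `EisensteinPowerBasisNorms.norm_coeff_coord_le_of_norm_coeff_sum_le` splits it along the power basis); packaged as
  ★★ `exists_coords_formalLog_secondKind`.

Purpose (crux K★ `stmt-BirchSwinnertonDyer-22226`, line `kato_lever`, memo `Lines/kato-lever-K2-ramified-cm-transport.md` §8): these are exactly the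
hypotheses of the tree's kernel theorem `KatzRankAllFibres.padicRankTwo (E₀ ⊗ ℤ_p)` for each `ℓᵢ` (after the isometric identification `K₀ = ℚ_p`),
whence `log_{W_D} ≡ A·log_{E₀} + B·log_{E₀}(Xᵖ)` modulo bounded series with `A, B ∈ L = ℚ_p(ϖ)` — the transported Hodge line of the CM-fibre road
(done Summits-side). BSD / K★ are not proved here; nothing about elliptic curves over number fields is proved in this file.

## References
* N. M. Katz, *Crystalline cohomology, Dieudonné modules, and Jacobi sums* (1981), Key Lemma 5.1.3, Thm. 5.1.4, Thm. 5.3.3. [Katz1981CrystallineDieudonne]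
* J.-P. Serre, *Local Fields* (1979), Ch. I §6 Prop. 17–18. [SerreLocalFields1979]
* J. H. Silverman, *The Arithmetic of Elliptic Curves* (2009), IV.1, IV.4.2, IV.5.5. [SilvermanAEC2009]
-/

noncomputable section

open scoped Classical
open ValuativeRel Field

namespace Literature.NumberTheory.PAdicHodge

open Literature.NumberTheory.GaloisRepresentations Literature.NumberTheory.GaloisRepresentations.IsNonarchimedeanLocalField

variable {F : Type} [Field F] [ValuativeRel F] [TopologicalSpace F] [IsNonarchimedeanLocalField F] [CharZero F]
  {p : ℕ} [hpp : Fact p.Prime] {hp : valuation F p < 1} (D : EisensteinRoot F p hp)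

/-! ## §1 `φ_D` in power-basis coordinates -/

/-- `zpToF = (K₀ → F) ∘ (ℤ_p → K₀)`. [cite: SerreLocalFields1979, Ch. II §5] -/
theorem zpToF_eq_algebraMap_ofPadicInt (hp : valuation F p < 1) (z : ℤ_[p]) :
    zpToF hp z = algebraMap (PadicBase F p hp) F (PadicBase.ofPadicInt hp z) := rfl

/-- **An element of `𝒪_D = ℤ_p[ϱ]` is the power-basis combination of its coordinates**: `x = Σ_{i<e} xᵢ·ϱⁱ`.
[cite: SerreLocalFields1979, Ch. I §6 Prop. 18] -/
theorem eq_sum_coords (x : D.Coeff) :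
    x = ∑ i : Fin D.e, AdjoinRoot.of D.poly ((AdjoinRoot.powerBasis' D.monic).basis.repr x (Fin.cast (D.e_def.trans (AdjoinRoot.powerBasis'_dim D.monic).symm) i)) * AdjoinRoot.root D.poly ^ (i : ℕ) := by
  conv_lhs => rw [← (AdjoinRoot.powerBasis' D.monic).basis.sum_repr x]
  rw [← (finCongr (D.e_def.trans (AdjoinRoot.powerBasis'_dim D.monic).symm)).sum_comp]
  refine Finset.sum_congr rfl fun i _ => ?_
  rw [finCongr_apply, PowerBasis.coe_basis, AdjoinRoot.powerBasis'_gen]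
  simp only [Fin.val_cast]
  rw [Algebra.smul_def, AdjoinRoot.algebraMap_eq]

/-- `𝒪_D → F` in coordinates: `toF x = Σ zpToF(xᵢ)·ϖⁱ`. [cite: SerreLocalFields1979, Ch. I §6 Prop. 18] -/
theorem toF_eq_sum_coords (x : D.Coeff) :
    EisensteinRoot.Coeff.toF D x = ∑ i : Fin D.e, zpToF hp ((AdjoinRoot.powerBasis' D.monic).basis.repr x (Fin.cast (D.e_def.trans (AdjoinRoot.powerBasis'_dim D.monic).symm) i)) * D.root ^ (i : ℕ) := by
  conv_lhs => rw [eq_sum_coords D x]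
  rw [map_sum]
  refine Finset.sum_congr rfl fun i _ => ?_
  rw [map_mul, map_pow, EisensteinRoot.Coeff.toF_of, EisensteinRoot.Coeff.toF_root]

/-- ★ **`φ_D(y) = Σ_{i<e} ι(yᵢ)·ϖ_Cⁱ` in `ℂ_F`** (`yᵢ ∈ ℤ_p` the power-basis coordinates of `y ∈ 𝒪_D`). [cite: SerreLocalFields1979, Ch. I §6 Prop. 18] -/
theorem toCBall_eq_sum_coords (y : EisensteinRoot.CoeffDisc D) :
    ((CBall F).subtype.comp (EisensteinRoot.CoeffDisc.toCBall D)) y =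
      ∑ i : Fin D.e, algebraMap F (CompletedAlgClosure F) (algebraMap (PadicBase F p hp) F
          (PadicBase.ofPadicInt hp ((AdjoinRoot.powerBasis' D.monic).basis.repr ((EisensteinRoot.CoeffDisc.of D).symm y) (Fin.cast (D.e_def.trans (AdjoinRoot.powerBasis'_dim D.monic).symm) i)))) *
        ((D.rootC : integerC F) : CompletedAlgClosure F) ^ (i : ℕ) := by
  have hy : y = EisensteinRoot.CoeffDisc.of D ((EisensteinRoot.CoeffDisc.of D).symm y) := ((EisensteinRoot.CoeffDisc.of D).apply_symm_apply y).symm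
  conv_lhs => rw [hy]
  rw [RingHom.comp_apply, Subring.subtype_apply, EisensteinRoot.CoeffDisc.coe_toCBall, toF_eq_sum_coords, map_sum]
  refine Finset.sum_congr rfl fun i _ => ?_
  rw [map_mul, map_pow]
  rfl

/-! ## §2 The coordinate series of `log_W` -/

/-- The coordinate series have no constant term. [cite: SilvermanAEC2009, IV.5.5] -/
theorem constantCoeff_coord (W : WeierstrassCurve (EisensteinRoot.CoeffDisc D)) (i : Fin D.e) :
    PowerSeries.constantCoeff (PowerSeries.mk fun n => algebraMap ℚ (PadicBase F p hp) (1 / (n : ℚ)) *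
        PadicBase.ofPadicInt hp ((AdjoinRoot.powerBasis' D.monic).basis.repr
          ((EisensteinRoot.CoeffDisc.of D).symm (PowerSeries.coeff (n - 1) W.formalInvDiff)) (Fin.cast (D.e_def.trans (AdjoinRoot.powerBasis'_dim D.monic).symm) i))) = 0 := by
  rw [← PowerSeries.coeff_zero_eq_constantCoeff_apply, PowerSeries.coeff_mk, Nat.cast_zero, div_zero, map_zero, zero_mul]

/-- **The coordinate series are LOG-TYPE**: `‖n·[Xⁿ]ℓᵢ‖_{K₀} ≤ 1` (`n·[Xⁿ]ℓᵢ = (b_{n−1})ᵢ ∈ ℤ_p`). [cite: SilvermanAEC2009, IV.5.5] -/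
theorem norm_natCast_mul_coeff_coord_le_one (W : WeierstrassCurve (EisensteinRoot.CoeffDisc D)) (i : Fin D.e) (n : ℕ) :
    ‖(n : PadicBase F p hp) * PowerSeries.coeff n (PowerSeries.mk fun n => algebraMap ℚ (PadicBase F p hp) (1 / (n : ℚ)) *
        PadicBase.ofPadicInt hp ((AdjoinRoot.powerBasis' D.monic).basis.repr
          ((EisensteinRoot.CoeffDisc.of D).symm (PowerSeries.coeff (n - 1) W.formalInvDiff)) (Fin.cast (D.e_def.trans (AdjoinRoot.powerBasis'_dim D.monic).symm) i)))‖ ≤ 1 := by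
  rw [PowerSeries.coeff_mk, ← mul_assoc]
  rcases n with _ | k
  · rw [Nat.cast_zero, zero_mul, zero_mul, norm_zero]; exact zero_le_one
  · have hk : ((k + 1 : ℕ) : ℚ) ≠ 0 := by positivity
    have h1 : ((k + 1 : ℕ) : PadicBase F p hp) * algebraMap ℚ (PadicBase F p hp) (1 / ((k + 1 : ℕ) : ℚ)) = 1 := by
      rw [← map_natCast (algebraMap ℚ (PadicBase F p hp)), ← map_mul, mul_one_div_cancel hk, map_one]
    rw [h1, one_mul]
    exact PadicBase.norm_ofPadicInt_le_one hp _

/-! ## §3 Substitution acts coordinatewise -/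

/-- **Substitution of an integral-base-changed argument acts coordinatewise**: for `a ∈ K₀⟦X_τ⟧` without constant term,
`(Σ cᵢ·ι_*ℓᵢ)(ι_*a) = Σ cᵢ·ι_*(ℓᵢ(a))`. [cite: Katz1981CrystallineDieudonne, §5.1] -/
theorem subst_sum_map {τ : Type*} (c : Fin D.e → CompletedAlgClosure F) (ℓ : Fin D.e → PowerSeries (PadicBase F p hp))
    (a : MvPowerSeries τ (PadicBase F p hp)) (ha : MvPowerSeries.constantCoeff a = 0) :
    (∑ i : Fin D.e, PowerSeries.C (c i) *
        PowerSeries.map ((algebraMap F (CompletedAlgClosure F)).comp (algebraMap (PadicBase F p hp) F)) (ℓ i)).subst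
      (MvPowerSeries.map ((algebraMap F (CompletedAlgClosure F)).comp (algebraMap (PadicBase F p hp) F)) a) =
    ∑ i : Fin D.e, MvPowerSeries.C (c i) *
      MvPowerSeries.map ((algebraMap F (CompletedAlgClosure F)).comp (algebraMap (PadicBase F p hp) F)) ((ℓ i).subst a) := by
  have hsa : PowerSeries.HasSubst a := PowerSeries.HasSubst.of_constantCoeff_zero ha
  have hsa' : PowerSeries.HasSubst
      (MvPowerSeries.map ((algebraMap F (CompletedAlgClosure F)).comp (algebraMap (PadicBase F p hp) F)) a) :=
    PowerSeries.HasSubst.of_constantCoeff_zero (by rw [MvPowerSeries.constantCoeff_map, ha, map_zero])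
  rw [← PowerSeries.coe_substAlgHom hsa', map_sum]
  refine Finset.sum_congr rfl fun i _ => ?_
  rw [map_mul, PowerSeries.coe_substAlgHom hsa', PowerSeries.subst_C, ← PowerSeries.map_subst hsa]

/-- ★ **The `F_{E₀}`-coboundary acts coordinatewise**: `Λ_{E₀}(Σ cᵢ·ι_*ℓᵢ) = Σ cᵢ·ι_*(Λ_{E₀}ℓᵢ)`, where
`Λ_{E₀}(g) = g(F_{E₀}(X,Y)) − g(X) − g(Y)` (`F_{E₀}` has coefficients in `ℤ`). [cite: Katz1981CrystallineDieudonne, §5.1] -/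
theorem cocycle_sum_map (c : Fin D.e → CompletedAlgClosure F) (ℓ : Fin D.e → PowerSeries (PadicBase F p hp)) (E₀ : WeierstrassCurve ℤ) :
    (∑ i : Fin D.e, PowerSeries.C (c i) *
        PowerSeries.map ((algebraMap F (CompletedAlgClosure F)).comp (algebraMap (PadicBase F p hp) F)) (ℓ i)).subst
        (E₀.map (Int.castRingHom (CompletedAlgClosure F))).formalGroupLaw -
      (∑ i : Fin D.e, PowerSeries.C (c i) *
        PowerSeries.map ((algebraMap F (CompletedAlgClosure F)).comp (algebraMap (PadicBase F p hp) F)) (ℓ i)).subst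
        (MvPowerSeries.X 0 : MvPowerSeries (Fin 2) (CompletedAlgClosure F)) -
      (∑ i : Fin D.e, PowerSeries.C (c i) *
        PowerSeries.map ((algebraMap F (CompletedAlgClosure F)).comp (algebraMap (PadicBase F p hp) F)) (ℓ i)).subst
        (MvPowerSeries.X 1 : MvPowerSeries (Fin 2) (CompletedAlgClosure F)) =
    ∑ i : Fin D.e, MvPowerSeries.C (c i) *
      MvPowerSeries.map ((algebraMap F (CompletedAlgClosure F)).comp (algebraMap (PadicBase F p hp) F))
        ((ℓ i).subst (E₀.map (Int.castRingHom (PadicBase F p hp))).formalGroupLaw -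
          (ℓ i).subst (MvPowerSeries.X 0 : MvPowerSeries (Fin 2) (PadicBase F p hp)) -
          (ℓ i).subst (MvPowerSeries.X 1 : MvPowerSeries (Fin 2) (PadicBase F p hp))) := by
  set ι : PadicBase F p hp →+* CompletedAlgClosure F := (algebraMap F (CompletedAlgClosure F)).comp (algebraMap (PadicBase F p hp) F)
    with hι
  have hE : (E₀.map (Int.castRingHom (CompletedAlgClosure F))).formalGroupLaw =
      MvPowerSeries.map ι (E₀.map (Int.castRingHom (PadicBase F p hp))).formalGroupLaw := by
    have hc : ι.comp (Int.castRingHom (PadicBase F p hp)) = Int.castRingHom (CompletedAlgClosure F) := RingHom.ext_int _ _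
    rw [← WeierstrassCurve.map_formalGroupLaw, ← WeierstrassCurve.map_formalGroupLaw, MvPowerSeries.map_map, hc]
  have hX0 : (MvPowerSeries.X 0 : MvPowerSeries (Fin 2) (CompletedAlgClosure F)) =
      MvPowerSeries.map ι (MvPowerSeries.X 0 : MvPowerSeries (Fin 2) (PadicBase F p hp)) := (MvPowerSeries.map_X _ _).symm
  have hX1 : (MvPowerSeries.X 1 : MvPowerSeries (Fin 2) (CompletedAlgClosure F)) =
      MvPowerSeries.map ι (MvPowerSeries.X 1 : MvPowerSeries (Fin 2) (PadicBase F p hp)) := (MvPowerSeries.map_X _ _).symm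
  rw [hE, hX0, hX1, subst_sum_map D c ℓ _ (E₀.map (Int.castRingHom (PadicBase F p hp))).constantCoeff_formalGroupLaw,
    subst_sum_map D c ℓ _ (MvPowerSeries.constantCoeff_X 0), subst_sum_map D c ℓ _ (MvPowerSeries.constantCoeff_X 1),
    ← Finset.sum_sub_distrib, ← Finset.sum_sub_distrib]
  refine Finset.sum_congr rfl fun i _ => ?_
  rw [map_sub, map_sub, mul_sub, mul_sub]

/-! ## §4 `log_W` in coordinates; the coordinate series are of the second kind for `F_{E₀}` -/

section RatAlgebra

/-! `ℂ_F` has characteristic `0`; the instance is not global in the tree (`CompletedAlgClosure.charZero`-style arguments are passed as `[CharZero ℂ_F]`). -/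
variable [CharZero (CompletedAlgClosure F)]

/-- `ι ∘ (ℚ → K₀) = (ℚ → ℂ_F)` (ring maps out of `ℚ` are unique). [cite: SerreLocalFields1979, Ch. II §5] -/
theorem iota_algebraMap_rat (hp : valuation F p < 1) (q : ℚ) :
    algebraMap F (CompletedAlgClosure F) (algebraMap (PadicBase F p hp) F (algebraMap ℚ (PadicBase F p hp) q)) =
      algebraMap ℚ (CompletedAlgClosure F) q := by
  have h : ((algebraMap F (CompletedAlgClosure F)).comp (algebraMap (PadicBase F p hp) F)).comp (algebraMap ℚ (PadicBase F p hp)) =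
      algebraMap ℚ (CompletedAlgClosure F) := Subsingleton.elim _ _
  exact RingHom.congr_fun h q

/-- ★ **`log_{W ⊗ ℂ_F} = Σ_{i<e} ϖ_Cⁱ · ι_*(ℓᵢ)`** with the coordinate series `ℓᵢ = Σ_{n≥1} (b_{n−1})ᵢ/n·Xⁿ ∈ K₀⟦X⟧`, `b_k ∈ 𝒪_D` the coefficients
of the invariant differential of `W` (`log_W = Σ b_{n−1}/n·Xⁿ`, AEC IV.5.5, and `b_k = Σ_i (b_k)ᵢ ϱⁱ`). [cite: SilvermanAEC2009, IV.5.5]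
[cite: SerreLocalFields1979, Ch. I §6 Prop. 18] -/
theorem formalLog_map_eq_sum_coords (W : WeierstrassCurve (EisensteinRoot.CoeffDisc D)) :
    (W.map ((CBall F).subtype.comp (EisensteinRoot.CoeffDisc.toCBall D))).formalLog =
      ∑ i : Fin D.e, PowerSeries.C (((D.rootC : integerC F) : CompletedAlgClosure F) ^ (i : ℕ)) *
        PowerSeries.map ((algebraMap F (CompletedAlgClosure F)).comp (algebraMap (PadicBase F p hp) F))
          (PowerSeries.mk fun n => algebraMap ℚ (PadicBase F p hp) (1 / (n : ℚ)) *
            PadicBase.ofPadicInt hp ((AdjoinRoot.powerBasis' D.monic).basis.repr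
              ((EisensteinRoot.CoeffDisc.of D).symm (PowerSeries.coeff (n - 1) W.formalInvDiff)) (Fin.cast (D.e_def.trans (AdjoinRoot.powerBasis'_dim D.monic).symm) i))) := by
  ext n
  rw [map_sum]
  rcases n with _ | k
  · rw [PowerSeries.coeff_zero_eq_constantCoeff, WeierstrassCurve.constantCoeff_formalLog]
    symm
    refine Finset.sum_eq_zero fun i _ => ?_
    rw [← PowerSeries.coeff_zero_eq_constantCoeff_apply, PowerSeries.coeff_C_mul, PowerSeries.coeff_map, PowerSeries.coeff_mk,
      Nat.cast_zero, div_zero, map_zero, zero_mul, map_zero, mul_zero]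
  · rw [Literature.NumberTheory.EllipticCurves.coeff_succ_formalLog_eq, coeff_formalOmega_map_eq_apply, toCBall_eq_sum_coords,
      Finset.mul_sum]
    refine Finset.sum_congr rfl fun i _ => ?_
    rw [PowerSeries.coeff_C_mul, PowerSeries.coeff_map, PowerSeries.coeff_mk, RingHom.comp_apply, map_mul, map_mul,
      iota_algebraMap_rat, Nat.add_sub_cancel, Nat.cast_succ]
    ring

/-- ★★ **Every coordinate series of `log_W` is of the SECOND KIND for `F_{E₀}` when `W ≡ E₀ (mod ϱ)`**: if
`‖ϖ_C‖ʲ ≤ M·‖j‖` for all `j ≥ 1`, then `‖[X^d](ℓᵢ(F_{E₀}(X,Y)) − ℓᵢ(X) − ℓᵢ(Y))‖_{K₀} ≤ M/‖p‖` for all `d` and all `i < e`.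
[cite: Katz1981CrystallineDieudonne, Key Lemma 5.1.3, Thm. 5.1.4] [cite: SerreLocalFields1979, Ch. I §6 Prop. 18] -/
theorem norm_coeff_cocycle_coord_le (W : WeierstrassCurve (EisensteinRoot.CoeffDisc D)) (E₀ : WeierstrassCurve ℤ)
    (hWE : W.map (Ideal.Quotient.mk (Ideal.span {EisensteinRoot.CoeffDisc.of D (AdjoinRoot.root D.poly)})) =
      (E₀.map (algebraMap ℤ (EisensteinRoot.CoeffDisc D))).map
        (Ideal.Quotient.mk (Ideal.span {EisensteinRoot.CoeffDisc.of D (AdjoinRoot.root D.poly)})))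
    {M : ℝ} (hM0 : 0 ≤ M) (hM : ∀ j : ℕ, 1 ≤ j → ‖((D.rootC : integerC F) : CompletedAlgClosure F)‖ ^ j ≤ M * ‖(j : CompletedAlgClosure F)‖)
    (i : Fin D.e) (d : Fin 2 →₀ ℕ) :
    ‖MvPowerSeries.coeff d
      ((PowerSeries.mk fun n => algebraMap ℚ (PadicBase F p hp) (1 / (n : ℚ)) *
          PadicBase.ofPadicInt hp ((AdjoinRoot.powerBasis' D.monic).basis.repr
            ((EisensteinRoot.CoeffDisc.of D).symm (PowerSeries.coeff (n - 1) W.formalInvDiff)) (Fin.cast (D.e_def.trans (AdjoinRoot.powerBasis'_dim D.monic).symm) i))).subst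
          (E₀.map (Int.castRingHom (PadicBase F p hp))).formalGroupLaw -
        (PowerSeries.mk fun n => algebraMap ℚ (PadicBase F p hp) (1 / (n : ℚ)) *
          PadicBase.ofPadicInt hp ((AdjoinRoot.powerBasis' D.monic).basis.repr
            ((EisensteinRoot.CoeffDisc.of D).symm (PowerSeries.coeff (n - 1) W.formalInvDiff)) (Fin.cast (D.e_def.trans (AdjoinRoot.powerBasis'_dim D.monic).symm) i))).subst
          (MvPowerSeries.X 0 : MvPowerSeries (Fin 2) (PadicBase F p hp)) -
        (PowerSeries.mk fun n => algebraMap ℚ (PadicBase F p hp) (1 / (n : ℚ)) *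
          PadicBase.ofPadicInt hp ((AdjoinRoot.powerBasis' D.monic).basis.repr
            ((EisensteinRoot.CoeffDisc.of D).symm (PowerSeries.coeff (n - 1) W.formalInvDiff)) (Fin.cast (D.e_def.trans (AdjoinRoot.powerBasis'_dim D.monic).symm) i))).subst
          (MvPowerSeries.X 1 : MvPowerSeries (Fin 2) (PadicBase F p hp)))‖ ≤ M / ‖(p : CompletedAlgClosure F)‖ := by
  have hφ1 : ∀ x, ‖((CBall F).subtype.comp (EisensteinRoot.CoeffDisc.toCBall D)) x‖ ≤ 1 := norm_subtype_comp_toCBall_le_one D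
  have hφc : ‖((CBall F).subtype.comp (EisensteinRoot.CoeffDisc.toCBall D)) (EisensteinRoot.CoeffDisc.of D (AdjoinRoot.root D.poly))‖ =
      ‖((D.rootC : integerC F) : CompletedAlgClosure F)‖ := norm_subtype_comp_toCBall_root D
  have hM' : ∀ j : ℕ, 1 ≤ j → ‖((CBall F).subtype.comp (EisensteinRoot.CoeffDisc.toCBall D))
      (EisensteinRoot.CoeffDisc.of D (AdjoinRoot.root D.poly))‖ ^ j ≤ M * ‖(j : CompletedAlgClosure F)‖ := by
    intro j hj; rw [hφc]; exact hM j hj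
  have hB := fun d => norm_coeff_formalLog_map_cocycle_wrt_int_le _ hφ1 _ W E₀ hWE hM0 hM' d
  set ℓ : Fin D.e → PowerSeries (PadicBase F p hp) := fun j => PowerSeries.mk fun n => algebraMap ℚ (PadicBase F p hp) (1 / (n : ℚ)) *
      PadicBase.ofPadicInt hp ((AdjoinRoot.powerBasis' D.monic).basis.repr
        ((EisensteinRoot.CoeffDisc.of D).symm (PowerSeries.coeff (n - 1) W.formalInvDiff))
          (Fin.cast (D.e_def.trans (AdjoinRoot.powerBasis'_dim D.monic).symm) j)) with hℓ
  have hlog := formalLog_map_eq_sum_coords D W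
  have key : ∀ d' : Fin 2 →₀ ℕ, ‖MvPowerSeries.coeff d' (∑ j : Fin D.e,
      MvPowerSeries.C (((D.rootC : integerC F) : CompletedAlgClosure F) ^ (j : ℕ)) *
        MvPowerSeries.map ((algebraMap F (CompletedAlgClosure F)).comp (algebraMap (PadicBase F p hp) F))
          ((ℓ j).subst (E₀.map (Int.castRingHom (PadicBase F p hp))).formalGroupLaw -
            (ℓ j).subst (MvPowerSeries.X 0 : MvPowerSeries (Fin 2) (PadicBase F p hp)) -
            (ℓ j).subst (MvPowerSeries.X 1 : MvPowerSeries (Fin 2) (PadicBase F p hp))))‖ ≤ M := fun d' => by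
    rw [← cocycle_sum_map D _ ℓ E₀, ← hlog]
    exact hB d'
  exact norm_coeff_coord_le_of_norm_coeff_sum_le D (fun j => (ℓ j).subst (E₀.map (Int.castRingHom (PadicBase F p hp))).formalGroupLaw -
    (ℓ j).subst (MvPowerSeries.X 0 : MvPowerSeries (Fin 2) (PadicBase F p hp)) -
    (ℓ j).subst (MvPowerSeries.X 1 : MvPowerSeries (Fin 2) (PadicBase F p hp))) key d i

/-- ★★ **Packaged: coordinates of `log_W` of the second kind for `F_{E₀}`.** For `W/𝒪_D` with `W ≡ E₀ (mod ϱ)` (`E₀/ℤ`) there are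
`ℓ₀, …, ℓ_{e−1} ∈ K₀⟦X⟧` with `ℓᵢ(0) = 0`, `‖n·[Xⁿ]ℓᵢ‖ ≤ 1`, `log_{W ⊗ ℂ_F} = Σ ϖ_Cⁱ·ι_*ℓᵢ`, and `‖[X^d]Λ_{E₀}(ℓᵢ)‖ ≤ M/‖p‖`
— the hypotheses of Katz's rank theorem (`KatzRankAllFibres.padicRankTwo`) for each `ℓᵢ`. [cite: Katz1981CrystallineDieudonne, Thm. 5.1.4, Thm. 5.3.3] -/
theorem exists_coords_formalLog_secondKind (W : WeierstrassCurve (EisensteinRoot.CoeffDisc D)) (E₀ : WeierstrassCurve ℤ)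
    (hWE : W.map (Ideal.Quotient.mk (Ideal.span {EisensteinRoot.CoeffDisc.of D (AdjoinRoot.root D.poly)})) =
      (E₀.map (algebraMap ℤ (EisensteinRoot.CoeffDisc D))).map
        (Ideal.Quotient.mk (Ideal.span {EisensteinRoot.CoeffDisc.of D (AdjoinRoot.root D.poly)})))
    {M : ℝ} (hM0 : 0 ≤ M) (hM : ∀ j : ℕ, 1 ≤ j → ‖((D.rootC : integerC F) : CompletedAlgClosure F)‖ ^ j ≤ M * ‖(j : CompletedAlgClosure F)‖) :
    ∃ ℓ : Fin D.e → PowerSeries (PadicBase F p hp),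
      (∀ i, PowerSeries.constantCoeff (ℓ i) = 0) ∧
      (∀ i (n : ℕ), ‖(n : PadicBase F p hp) * PowerSeries.coeff n (ℓ i)‖ ≤ 1) ∧
      (W.map ((CBall F).subtype.comp (EisensteinRoot.CoeffDisc.toCBall D))).formalLog =
        ∑ i : Fin D.e, PowerSeries.C (((D.rootC : integerC F) : CompletedAlgClosure F) ^ (i : ℕ)) *
          PowerSeries.map ((algebraMap F (CompletedAlgClosure F)).comp (algebraMap (PadicBase F p hp) F)) (ℓ i) ∧
      (∀ i (d : Fin 2 →₀ ℕ), ‖MvPowerSeries.coeff d ((ℓ i).subst (E₀.map (Int.castRingHom (PadicBase F p hp))).formalGroupLaw -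
          (ℓ i).subst (MvPowerSeries.X 0 : MvPowerSeries (Fin 2) (PadicBase F p hp)) -
          (ℓ i).subst (MvPowerSeries.X 1 : MvPowerSeries (Fin 2) (PadicBase F p hp)))‖ ≤ M / ‖(p : CompletedAlgClosure F)‖) :=
  ⟨fun i => PowerSeries.mk fun n => algebraMap ℚ (PadicBase F p hp) (1 / (n : ℚ)) *
      PadicBase.ofPadicInt hp ((AdjoinRoot.powerBasis' D.monic).basis.repr
        ((EisensteinRoot.CoeffDisc.of D).symm (PowerSeries.coeff (n - 1) W.formalInvDiff)) (Fin.cast (D.e_def.trans (AdjoinRoot.powerBasis'_dim D.monic).symm) i)),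
    fun i => constantCoeff_coord D W i, fun i n => norm_natCast_mul_coeff_coord_le_one D W i n, formalLog_map_eq_sum_coords D W,
    fun i d => norm_coeff_cocycle_coord_le D W E₀ hWE hM0 hM i d⟩

end RatAlgebra

end Literature.NumberTheory.PAdicHodge
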